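import Literature.Analysis.FluidPDE.JiaSverak2014PerturbedLocalEnergy
import Literature.Analysis.FluidPDE.PressureDeterminedUpToTime
import Literature.Analysis.FluidPDE.LocalEnergyLimitBounds
import Literature.Analysis.FluidPDE.JiaSverak2014SlabPressureGauge
import Literature.Analysis.FluidPDE.SuitableWeakExhaustion
import Literature.Analysis.FluidPDE.ClassicalSuitable
import HarnessLib

/-!
# Jia–Šverák 2014, proof of Thm. 3.1: the perturbed local energy inequality on the slab, with the
  local Leray pressure of the regular flow

Analysis/FluidPDE proofs file (theorems only, no new definitions, no new named facts), part of
the proof of the named fact `Literature.Analysis.FluidPDE.jia_sverak_2014_theorem_3_2`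
(`JiaSverak2014LocalRegularity.lean`; H. Jia, V. Šverák, Invent. Math. 196 (2014) =
arXiv:1204.0529, §3 Thm. 3.2). It instantiates the abstract perturbed local energy inequality
`JiaSverak2014.perturbed_local_energy_inequality` (the "three balances", Lemarié-Rieusset 2016,
proof of Thm. 14.7) for the data of the printed proof of Thm. 3.1 (arXiv p. 8): a local Leray
solution `(u, p)` on a slab and the regular mild flow `a` of `JiaSverak2014.exists_regular_flow`,
whose two pressures — the local Leray pressure `p_K` (integrable up to `t = 0`, with the local
pressure expansion) and the classical pressure `π` (smooth, in the pointwise equations) — differ by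
a function of time (`exists_measurable_gauge_of_forall_integral_mul_divergence_eq_zero`), so that
the inequality holds with `q = p - p_K`:

* `perturbed_local_energy_inequality_slab` — for every nonnegative test function `Φ` on the open
  slab `(0, S) × ℝ³`, `S = min(T', S₀)`,
  `2 ∫∫ |∇v|² Φ ≤ ∫∫ |v|²(Φₜ + ΔΦ) + ∫∫ |v|² u·∇Φ + 2 ∫∫ (p - p_K) v·∇Φ - 2 ∫∫ Φ ⟪Da(v), v⟫`
  (`v = u - a`, `∇v = G - Da`).

Ingredients proved here: a smooth time plateau and the global smoothness of the cut-off flow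
`ζ(t) a(t, x)` (the abstract inequality wants a globally smooth regular field; the classical flow
is smooth on `(0, S₂) × ℝ³` only), the vanishing of `∫∫ (p_K - π) div ψ` (both pairs `(a, p_K)`,
`(a, π)` solve Navier–Stokes in `𝒟'`), the `L^{3/2}` integrability of the gauge `c = p_K - π` on
interior time intervals, and the renormalisation `p ↦ p - c` (`Seregin2014Limit.isSuitableWeakSolutionOn_sub_gauge`).

## References

* H. Jia, V. Šverák, Invent. Math. 196 (2014) = arXiv:1204.0529, §3 Thm. 3.1 and its proof
  (pp. 7–8). Bib key `JiaSverak2014`.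
* P. G. Lemarié-Rieusset, *The Navier–Stokes Problem in the 21st Century* (2016), Thm. 14.7
  (proof pp. 515–516), Thm. 15.1 (A). Bib key `LemarieRieusset2016`.
-/

noncomputable section

open MeasureTheory TopologicalSpace Set Function Filter Metric
open _root_.Topology
open scoped ENNReal NNReal RealInnerProductSpace Laplacian

namespace Literature.Analysis.FluidPDE

namespace JiaSverak2014

/-! ### A smooth time plateau -/

/-- **A smooth plateau in time**: for `0 < t₁ ≤ t₂ < S` there is a smooth `ζ : ℝ → [0,1]` with
`ζ = 1` on `[t₁, t₂]` and `tsupport ζ ⊆ (0, S)` (indeed `⊆ [t₁/2, (t₂+S)/2]`). [folklore] -/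
theorem exists_time_plateau {t₁ t₂ S : ℝ} (h1 : 0 < t₁) (h12 : t₁ ≤ t₂) (h2 : t₂ < S) :
    ∃ ζ : ℝ → ℝ, ContDiff ℝ (⊤ : ℕ∞) ζ ∧ (∀ t, 0 ≤ ζ t) ∧ (∀ t, ζ t ≤ 1) ∧
      (∀ t ∈ Icc t₁ t₂, ζ t = 1) ∧ (∀ t ∈ Ioo t₁ t₂, ∀ᶠ s in 𝓝 t, ζ s = 1) ∧
      tsupport ζ ⊆ Icc (t₁ / 2) ((t₂ + S) / 2) := by
  set δ : ℝ := min (t₁ / 2) ((S - t₂) / 2) with hδ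
  have hδ0 : 0 < δ := lt_min (by linarith) (by linarith)
  let θ : ContDiffBump ((t₁ + t₂) / 2 : ℝ) :=
    ⟨(t₂ - t₁) / 2 + δ / 2, (t₂ - t₁) / 2 + δ, by positivity, by linarith⟩
  have hθrIn : θ.rIn = (t₂ - t₁) / 2 + δ / 2 := rfl
  have hθrOut : θ.rOut = (t₂ - t₁) / 2 + δ := rfl
  have hone : ∀ t ∈ Icc (t₁ - δ / 2) (t₂ + δ / 2), (θ : ℝ → ℝ) t = 1 := fun t ht =>
    θ.one_of_mem_closedBall (by
      rw [mem_closedBall, Real.dist_eq, hθrIn, abs_le]; constructor <;> linarith [ht.1, ht.2])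
  have hsupp : support (θ : ℝ → ℝ) ⊆ Ioo (t₁ - δ) (t₂ + δ) := by
    intro t ht
    rw [θ.support_eq, mem_ball, Real.dist_eq, hθrOut, abs_lt] at ht
    exact ⟨by linarith [ht.1], by linarith [ht.2]⟩
  refine ⟨θ, θ.contDiff, fun t => θ.nonneg, fun t => θ.le_one, fun t ht => hone t ⟨by linarith [ht.1], by linarith [ht.2]⟩,
    fun t ht => ?_, ?_⟩
  · filter_upwards [Ioo_mem_nhds (show t₁ - δ / 2 < t by linarith [ht.1]) (show t < t₂ + δ / 2 by linarith [ht.2])]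
      with s hs using hone s ⟨hs.1.le, hs.2.le⟩
  · refine (closure_mono hsupp).trans ?_
    rw [closure_Ioo (by linarith)]
    exact Icc_subset_Icc (by linarith [min_le_left (t₁ / 2) ((S - t₂) / 2)])
      (by linarith [min_le_right (t₁ / 2) ((S - t₂) / 2)])

/-! ### Global smoothness of the cut-off flow -/

/-- **Cutting off a field that is smooth on an open time slab**: if `a` is jointly `C^∞` on
`(0, S₂) × E` and `ζ : ℝ → ℝ` is smooth with `tsupport ζ ⊆ (0, S₂)`, then `(t, x) ↦ ζ(t) a(t, x)`
is jointly `C^∞` on all of `ℝ × E`. [folklore] -/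
theorem contDiff_uncurry_smul_of_contDiffOn {F : Type*} [NormedAddCommGroup F] [NormedSpace ℝ F]
    {S₂ : ℝ} {a : ℝ → (EuclideanSpace ℝ (Fin 3)) → F}
    (ha : ContDiffOn ℝ (⊤ : ℕ∞) (uncurry a) (Ioo 0 S₂ ×ˢ (univ : Set (EuclideanSpace ℝ (Fin 3)))))
    {ζ : ℝ → ℝ} (hζ : ContDiff ℝ (⊤ : ℕ∞) ζ) (hζs : tsupport ζ ⊆ Ioo 0 S₂) :
    ContDiff ℝ (⊤ : ℕ∞) (uncurry fun t x => ζ t • a t x) := by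
  rw [contDiff_iff_contDiffAt]
  rintro ⟨t, x⟩
  by_cases ht : t ∈ Ioo (0 : ℝ) S₂
  · -- inside the slab: product of smooth functions
    have hopen : IsOpen (Ioo (0 : ℝ) S₂ ×ˢ (univ : Set (EuclideanSpace ℝ (Fin 3)))) := isOpen_Ioo.prod isOpen_univ
    have hmem : Ioo (0 : ℝ) S₂ ×ˢ (univ : Set (EuclideanSpace ℝ (Fin 3))) ∈ 𝓝 (t, x) := hopen.mem_nhds ⟨ht, mem_univ _⟩
    have h1 : ContDiffAt ℝ (⊤ : ℕ∞) (uncurry a) (t, x) := ha.contDiffAt hmem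
    have h2 : ContDiffAt ℝ (⊤ : ℕ∞) (fun z : ℝ × EuclideanSpace ℝ (Fin 3) => ζ z.1) (t, x) :=
      (hζ.comp contDiff_fst).contDiffAt
    exact h2.smul h1
  · -- outside: `ζ` vanishes near `t`, so the product vanishes near `(t, x)`
    have ht' : t ∉ tsupport ζ := fun h => ht (hζs h)
    have h0 : ζ =ᶠ[𝓝 t] 0 := notMem_tsupport_iff_eventuallyEq.1 ht'
    have h0' : (uncurry fun t x => ζ t • a t x) =ᶠ[𝓝 (t, x)] fun _ => 0 := by
      have := (continuous_fst.tendsto (t, x)).eventually h0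
      filter_upwards [this] with z hz
      simp only [uncurry, hz, Pi.zero_apply, zero_smul]
    exact contDiffAt_const.congr_of_eventuallyEq h0'

/-- Divergence of `c • v`: `div (c v) = c div v` for a differentiable field. [folklore] -/
theorem divergence_const_smul {c : ℝ} {v : (EuclideanSpace ℝ (Fin 3)) → (EuclideanSpace ℝ (Fin 3))} {x : EuclideanSpace ℝ (Fin 3)}
    (hv : DifferentiableAt ℝ v x) :
    VectorCalculus.divergence (fun y => c • v y) x = c * VectorCalculus.divergence v x := by
  simp only [VectorCalculus.divergence]
  rw [show (fun y => c • v y) = c • v from rfl, fderiv_const_smul hv c]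
  rw [show ((c • fderiv ℝ v x : (EuclideanSpace ℝ (Fin 3)) →L[ℝ] (EuclideanSpace ℝ (Fin 3))) : (EuclideanSpace ℝ (Fin 3)) →ₗ[ℝ] (EuclideanSpace ℝ (Fin 3))) = c • (fderiv ℝ v x : (EuclideanSpace ℝ (Fin 3)) →ₗ[ℝ] (EuclideanSpace ℝ (Fin 3)))
    from rfl, map_smul, smul_eq_mul]

/-! ### The gauge `p_K - π` -/

/-- **The two pressures of the regular flow differ by a function of time.** Let `(a, p_K)` be a
local Leray solution on the slab `(0,S₀) × ℝ³` and `(a, π)` a classical solution on `(0, S₂)`,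
`S ≤ S₀`, `S ≤ S₂`. Then `∫∫ (p_K - π) div ψ = 0` for every vector test field `ψ` on the slab
`(0, S) × ℝ³` (both pairs solve the equations in `𝒟'`, with the same velocity), hence there is a
measurable `c` with `p_K - π = c(t)` a.e. on the slab
(`exists_measurable_gauge_of_forall_integral_mul_divergence_eq_zero`).
[cite: JiaSverak2014, §3 (3.3) (the constant c_{x₀}(t))] -/
theorem exists_gauge_two_pressures {S S₀ S₂ : ℝ}
    {a₀ : (EuclideanSpace ℝ (Fin 3)) → (EuclideanSpace ℝ (Fin 3))} {a : ℝ → (EuclideanSpace ℝ (Fin 3)) → (EuclideanSpace ℝ (Fin 3))} {π pK : ℝ → (EuclideanSpace ℝ (Fin 3)) → ℝ}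
    (hSS₀ : S ≤ S₀) (hSS₂ : S ≤ S₂)
    (hLK : IsLocalLeraySolutionOn S₀ 1 a₀ a pK) (hcl : IsClassicalNSSolutionOn (Ioo 0 S₂) 1 0 a π) :
    ∃ c : ℝ → ℝ, Measurable c ∧
      ∀ᵐ t ∂(volume.restrict (Ioo 0 S)), ∀ᵐ x ∂(volume : Measure (EuclideanSpace ℝ (Fin 3))), pK t x - π t x = c t := by
  set Q : Opens (ℝ × (EuclideanSpace ℝ (Fin 3))) := slab (EuclideanSpace ℝ (Fin 3)) (Ioo 0 S) isOpen_Ioo with hQ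
  have hQS₀ : Q ≤ slab (EuclideanSpace ℝ (Fin 3)) (Ioo 0 S₀) isOpen_Ioo := slab_mono (Ioo_subset_Ioo_right hSS₀)
  have hQS₂ : (Q : Set (ℝ × (EuclideanSpace ℝ (Fin 3)))) ⊆ Ioo 0 S₂ ×ˢ (univ : Set (EuclideanSpace ℝ (Fin 3))) :=
    prod_mono (Ioo_subset_Ioo_right hSS₂) Subset.rfl
  -- the two distributional identities on `Q`
  have hD₁ : IsDistributionalNSSolutionOn Q 1 0 a pK := hLK.distributional.of_le hQS₀
  have ha2 : ContDiffOn ℝ 2 (uncurry a) (Ioo 0 S₂ ×ˢ (univ : Set (EuclideanSpace ℝ (Fin 3)))) := hcl.smooth_velocity.of_le (by norm_cast)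
  have hπ1 : ContDiffOn ℝ 1 (uncurry π) (Ioo 0 S₂ ×ˢ (univ : Set (EuclideanSpace ℝ (Fin 3)))) := hcl.smooth_pressure.of_le (by norm_cast)
  have hmom : ∀ t ∈ Ioo (0 : ℝ) S₂, ∀ x, timeDeriv a t x + convect (a t) (a t) x =
      (1 : ℝ) • (Δ (a t)) x - gradient (π t) x + (0 : ℝ → (EuclideanSpace ℝ (Fin 3)) → (EuclideanSpace ℝ (Fin 3))) t x := by
    intro t ht x
    have h := hcl.momentum t ht x
    rwa [timeDerivWithin_of_mem_interior (by rwa [interior_Ioo]) x] at h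
  have hD₂ : IsDistributionalNSSolutionOn Q 1 0 a π :=
    isDistributionalNSSolutionOn_of_contDiffOn isOpen_Ioo hQS₂ ha2 hπ1
      (continuous_const.continuousOn) hmom hcl.divFree
  -- local integrability of `F = p_K - π` on the slab
  have hπc : ContinuousOn (uncurry π) (Q : Set (ℝ × (EuclideanSpace ℝ (Fin 3)))) := hπ1.continuousOn.mono hQS₂
  have hF : LocallyIntegrableOn (uncurry fun t x => pK t x - π t x) (Ioo 0 S ×ˢ (univ : Set (EuclideanSpace ℝ (Fin 3)))) volume :=
    hD₁.2.2.1.sub (hπc.locallyIntegrableOn (measurableSet_Ioo.prod MeasurableSet.univ))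
  refine exists_measurable_gauge_of_forall_integral_mul_divergence_eq_zero hF fun ψ hψ => ?_
  -- subtract the two momentum identities
  have h₁ := hD₁.2.2.2.2 ψ hψ
  have h₂ := hD₂.2.2.2.2 ψ hψ
  set K : Set (ℝ × (EuclideanSpace ℝ (Fin 3))) := tsupport (uncurry ψ) with hK
  have hKc : IsCompact K := hψ.hasCompactSupport
  have hKQ : K ⊆ (Q : Set (ℝ × (EuclideanSpace ℝ (Fin 3)))) := hψ.tsupport_subset
  have hψ' : IsSpaceTimeTestOn (⊤ : Opens (ℝ × (EuclideanSpace ℝ (Fin 3)))) ψ := hψ.mono le_top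
  -- the common velocity part and the pressure pairings, as integrable functions on `ℝ × ℝ³`
  have hdivc : Continuous fun z : ℝ × (EuclideanSpace ℝ (Fin 3)) => VectorCalculus.divergence (ψ z.1) z.2 := hψ'.continuous_divergence_slice
  have hdiv0 : ∀ z ∉ K, VectorCalculus.divergence (ψ z.1) z.2 = 0 := fun z hz => by
    have h0 : fderiv ℝ (ψ z.1) z.2 = 0 := IsSpaceTimeTestOn.fderiv_slice_eq_zero_of_notMem (ψ := ψ) hz
    simp [VectorCalculus.divergence, h0]
  have iP₁ : Integrable (fun z : ℝ × (EuclideanSpace ℝ (Fin 3)) => pK z.1 z.2 * VectorCalculus.divergence (ψ z.1) z.2) volume :=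
    integrable_mul_of_locallyIntegrableOn hD₁.2.2.1 hdivc hKc hKQ hdiv0
  have iP₂ : Integrable (fun z : ℝ × (EuclideanSpace ℝ (Fin 3)) => π z.1 z.2 * VectorCalculus.divergence (ψ z.1) z.2) volume :=
    integrable_mul_of_locallyIntegrableOn hD₂.2.2.1 hdivc hKc hKQ hdiv0
  set V : ℝ × (EuclideanSpace ℝ (Fin 3)) → ℝ := fun z => ⟪a z.1 z.2, timeDeriv ψ z.1 z.2⟫ + ⟪a z.1 z.2, convect (a z.1) (ψ z.1) z.2⟫ +
    1 * ⟪a z.1 z.2, Δ (ψ z.1) z.2⟫ with hV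
  -- `V` is continuous on `Q` and vanishes off `K`, hence integrable
  have hV0 : ∀ z ∉ K, V z = 0 := fun z hz => by
    simp only [hV, IsSpaceTimeTestOn.timeDeriv_eq_zero_of_notMem hz,
      laplacian_eq_zero_of_notMem_tsupport (notMem_tsupport_slice hz), inner_zero_right, mul_zero, add_zero,
      convect, IsSpaceTimeTestOn.fderiv_slice_eq_zero_of_notMem (ψ := ψ) hz, zero_apply]
  have hVc : ContinuousOn V (Q : Set (ℝ × (EuclideanSpace ℝ (Fin 3)))) := by
    have hac : ContinuousOn (fun z : ℝ × (EuclideanSpace ℝ (Fin 3)) => a z.1 z.2) (Q : Set (ℝ × (EuclideanSpace ℝ (Fin 3)))) := ha2.continuousOn.mono hQS₂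
    have hDψ : Continuous fun z : ℝ × (EuclideanSpace ℝ (Fin 3)) => fderiv ℝ (ψ z.1) z.2 := hψ'.continuous_fderiv_slice
    refine ((hac.inner hψ'.continuous_timeDeriv.continuousOn).add (hac.inner ?_)).add
      (continuousOn_const.mul (hac.inner hψ'.continuous_laplacian_slice.continuousOn))
    exact ((hDψ.continuousOn).clm_apply hac)
  have iV : Integrable V volume := by
    have hVK : IntegrableOn V K volume := (hVc.mono hKQ).integrableOn_compact hKc
    exact hVK.integrable_of_forall_notMem_eq_zero hV0
  -- the identities as statements about `∫ V + ∫ pressure`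
  have e₁ : ∫ (z : ℝ × (EuclideanSpace ℝ (Fin 3))) in (Q : Set (ℝ × (EuclideanSpace ℝ (Fin 3)))), (⟪a z.1 z.2, timeDeriv ψ z.1 z.2⟫ + ⟪a z.1 z.2, convect (a z.1) (ψ z.1) z.2⟫ +
      1 * ⟪a z.1 z.2, Δ (ψ z.1) z.2⟫ + pK z.1 z.2 * VectorCalculus.divergence (ψ z.1) z.2 +
      ⟪(0 : ℝ → (EuclideanSpace ℝ (Fin 3)) → (EuclideanSpace ℝ (Fin 3))) z.1 z.2, ψ z.1 z.2⟫) = (∫ z, V z) + ∫ z : ℝ × (EuclideanSpace ℝ (Fin 3)), pK z.1 z.2 * VectorCalculus.divergence (ψ z.1) z.2 := by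
    rw [setIntegral_eq_integral_of_forall_compl_eq_zero (fun z hz => by
      have hzK : z ∉ K := fun h => hz (hKQ h)
      simp only [hV] at hV0
      rw [hV0 z hzK, hdiv0 z hzK]; simp), ← integral_add iV iP₁]
    refine integral_congr_ae (Eventually.of_forall fun z => ?_)
    simp only [hV, Pi.zero_apply, inner_zero_left, add_zero]
  have e₂ : ∫ (z : ℝ × (EuclideanSpace ℝ (Fin 3))) in (Q : Set (ℝ × (EuclideanSpace ℝ (Fin 3)))), (⟪a z.1 z.2, timeDeriv ψ z.1 z.2⟫ + ⟪a z.1 z.2, convect (a z.1) (ψ z.1) z.2⟫ +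
      1 * ⟪a z.1 z.2, Δ (ψ z.1) z.2⟫ + π z.1 z.2 * VectorCalculus.divergence (ψ z.1) z.2 +
      ⟪(0 : ℝ → (EuclideanSpace ℝ (Fin 3)) → (EuclideanSpace ℝ (Fin 3))) z.1 z.2, ψ z.1 z.2⟫) = (∫ z, V z) + ∫ z : ℝ × (EuclideanSpace ℝ (Fin 3)), π z.1 z.2 * VectorCalculus.divergence (ψ z.1) z.2 := by
    rw [setIntegral_eq_integral_of_forall_compl_eq_zero (fun z hz => by
      have hzK : z ∉ K := fun h => hz (hKQ h)
      simp only [hV] at hV0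
      rw [hV0 z hzK, hdiv0 z hzK]; simp), ← integral_add iV iP₂]
    refine integral_congr_ae (Eventually.of_forall fun z => ?_)
    simp only [hV, Pi.zero_apply, inner_zero_left, add_zero]
  rw [e₁] at h₁
  rw [e₂] at h₂
  -- conclusion: `∫ (p_K - π) div ψ = 0`
  rw [setIntegral_eq_integral_of_forall_compl_eq_zero (fun z hz => by
    have hzK : z ∉ K := fun h => hz (hKQ h)
    rw [show VectorCalculus.divergence (ψ z.1) z.2 = 0 from hdiv0 z hzK, mul_zero])]
  have e3 : ∫ z : ℝ × (EuclideanSpace ℝ (Fin 3)), (pK z.1 z.2 - π z.1 z.2) * VectorCalculus.divergence (ψ z.1) z.2 =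
      ∫ z : ℝ × (EuclideanSpace ℝ (Fin 3)), (pK z.1 z.2 * VectorCalculus.divergence (ψ z.1) z.2 -
        π z.1 z.2 * VectorCalculus.divergence (ψ z.1) z.2) := by
    refine integral_congr_ae (Eventually.of_forall fun z => ?_)
    ring
  show ∫ z : ℝ × (EuclideanSpace ℝ (Fin 3)), (pK z.1 z.2 - π z.1 z.2) * VectorCalculus.divergence (ψ z.1) z.2 = 0
  rw [e3, integral_sub iP₁ iP₂]
  linarith

/-- **The gauge is in `L^{3/2}` on interior time intervals**: with `c` as in
`exists_gauge_two_pressures` and `0 < t₁ < t₂ < S`, `∫_{t₁}^{t₂} |c|^{3/2} < ∞`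
(`|c(t)|^{3/2} = |p_K - π|^{3/2}` a.e. on `(t₁,t₂) × B_1(0)`; `p_K ∈ L^{3/2}` on the boxes and `π`
is bounded on `[t₁,t₂] × B̄_1(0)`). [folklore] -/
theorem lintegral_gauge_rpow_lt_top {S S₀ S₂ : ℝ}
    {a₀ : (EuclideanSpace ℝ (Fin 3)) → (EuclideanSpace ℝ (Fin 3))} {a : ℝ → (EuclideanSpace ℝ (Fin 3)) → (EuclideanSpace ℝ (Fin 3))} {π pK : ℝ → (EuclideanSpace ℝ (Fin 3)) → ℝ}
    (hSS₀ : S ≤ S₀) (hSS₂ : S ≤ S₂)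
    (hLK : IsLocalLeraySolutionOn S₀ 1 a₀ a pK) (hcl : IsClassicalNSSolutionOn (Ioo 0 S₂) 1 0 a π)
    {c : ℝ → ℝ} (hcm : Measurable c)
    (hc : ∀ᵐ t ∂(volume.restrict (Ioo 0 S)), ∀ᵐ x ∂(volume : Measure (EuclideanSpace ℝ (Fin 3))), pK t x - π t x = c t)
    {t₁ t₂ : ℝ} (h1 : 0 < t₁) (h2 : t₂ < S) :
    ∫⁻ t in Ioo t₁ t₂, ‖c t‖ₑ ^ (3 / 2 : ℝ) < ∞ := by
  rcases le_or_gt t₂ t₁ with h12 | h12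
  · rw [Ioo_eq_empty (not_lt.2 h12)]; simp
  set B : Set (EuclideanSpace ℝ (Fin 3)) := ball (0 : (EuclideanSpace ℝ (Fin 3))) 1 with hB
  have hB0 : (volume : Measure (EuclideanSpace ℝ (Fin 3))) B ≠ 0 := (measure_ball_pos volume (0 : (EuclideanSpace ℝ (Fin 3))) one_pos).ne'
  have hBt : (volume : Measure (EuclideanSpace ℝ (Fin 3))) B ≠ ⊤ := measure_ball_lt_top.ne
  set I : Set ℝ := Ioo t₁ t₂ with hI
  have hIS : I ⊆ Ioo 0 S := Ioo_subset_Ioo h1.le h2.le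
  -- `|c t|^{3/2} |B| = ∫_B |p_K - π|^{3/2}` for a.e. `t ∈ I`
  have hct : ∀ᵐ t ∂(volume.restrict I), ‖c t‖ₑ ^ (3 / 2 : ℝ) * volume B =
      ∫⁻ x in B, ‖pK t x - π t x‖ₑ ^ (3 / 2 : ℝ) := by
    filter_upwards [ae_restrict_of_ae_restrict_of_subset hIS hc] with t ht
    rw [← setLIntegral_const]
    refine lintegral_congr_ae ((ae_restrict_of_ae ht).mono fun x hx => ?_)
    show ‖c t‖ₑ ^ (3 / 2 : ℝ) = ‖pK t x - π t x‖ₑ ^ (3 / 2 : ℝ)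
    rw [hx]
  -- integrate in time
  have hmeas : Measurable fun t => ‖c t‖ₑ ^ (3 / 2 : ℝ) * volume B := (hcm.enorm.pow_const _).mul_const _
  have hprod : (volume.restrict I).prod (volume.restrict B) = volume.restrict (I ×ˢ B) := by
    rw [Measure.prod_restrict, ← Measure.volume_eq_prod]
  -- measurability of `p_K - π` on the box
  have hpKm : AEStronglyMeasurable (uncurry pK) (volume.restrict (I ×ˢ B)) :=
    hLK.aestronglyMeasurable_pressure.mono_measure
      (Measure.restrict_mono (prod_mono (hIS.trans (Ioo_subset_Ioo_right hSS₀)) (subset_univ _)) le_rfl)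
  have hπc : ContinuousOn (uncurry π) (Icc t₁ t₂ ×ˢ closedBall (0 : (EuclideanSpace ℝ (Fin 3))) 1) :=
    hcl.smooth_pressure.continuousOn.mono (prod_mono (fun t ht => ⟨h1.trans_le ht.1, ht.2.trans_lt (h2.trans_le hSS₂)⟩)
      (subset_univ _))
  have hπm : AEStronglyMeasurable (uncurry π) (volume.restrict (I ×ˢ B)) :=
    (hπc.mono (prod_mono Ioo_subset_Icc_self Metric.ball_subset_closedBall)).aestronglyMeasurable
      (measurableSet_Ioo.prod measurableSet_ball)
  have hFm : AEMeasurable (fun z : ℝ × (EuclideanSpace ℝ (Fin 3)) => ‖pK z.1 z.2 - π z.1 z.2‖ₑ ^ (3 / 2 : ℝ)) (volume.restrict (I ×ˢ B)) :=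
    ((hpKm.sub hπm).enorm.pow_const _)
  have hTonelli : ∫⁻ t in I, ‖c t‖ₑ ^ (3 / 2 : ℝ) * volume B = ∫⁻ z in I ×ˢ B, ‖pK z.1 z.2 - π z.1 z.2‖ₑ ^ (3 / 2 : ℝ) := by
    rw [lintegral_congr_ae hct, ← hprod, lintegral_prod _ (by rw [hprod]; exact hFm)]
  -- the bound `|p_K - π|^{3/2} ≤ √2 (|p_K|^{3/2} + |π|^{3/2})`
  obtain ⟨Cπ, hCπ⟩ := (isCompact_Icc.prod (isCompact_closedBall (0 : (EuclideanSpace ℝ (Fin 3))) 1)).exists_bound_of_continuousOn hπc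
  have hfin : ∫⁻ z in I ×ˢ B, ‖pK z.1 z.2 - π z.1 z.2‖ₑ ^ (3 / 2 : ℝ) < ∞ := by
    have hpt : ∀ z ∈ I ×ˢ B, ‖pK z.1 z.2 - π z.1 z.2‖ₑ ^ (3 / 2 : ℝ) ≤
        (2 : ℝ≥0∞) ^ (1 / 2 : ℝ) * ‖pK z.1 z.2‖ₑ ^ (3 / 2 : ℝ) +
          (2 : ℝ≥0∞) ^ (1 / 2 : ℝ) * ENNReal.ofReal (max Cπ 0) ^ (3 / 2 : ℝ) := by
      intro z hz
      refine ((ENNReal.rpow_le_rpow (enorm_sub_le (E := ℝ)) (by norm_num)).trans (add_rpow_threeHalves_le _ _)).trans ?_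
      rw [mul_add]
      gcongr
      rw [← ofReal_norm]
      exact ENNReal.ofReal_le_ofReal ((hCπ ⟨z.1, z.2⟩ ⟨Ioo_subset_Icc_self hz.1, Metric.ball_subset_closedBall hz.2⟩).trans
        (le_max_left _ _))
    have s2 : (2 : ℝ≥0∞) ^ (1 / 2 : ℝ) ≠ ⊤ := ENNReal.rpow_ne_top_of_nonneg (by norm_num) ENNReal.ofNat_ne_top
    calc ∫⁻ z in I ×ˢ B, ‖pK z.1 z.2 - π z.1 z.2‖ₑ ^ (3 / 2 : ℝ)
        ≤ ∫⁻ z in I ×ˢ B, ((2 : ℝ≥0∞) ^ (1 / 2 : ℝ) * ‖pK z.1 z.2‖ₑ ^ (3 / 2 : ℝ) +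
            (2 : ℝ≥0∞) ^ (1 / 2 : ℝ) * ENNReal.ofReal (max Cπ 0) ^ (3 / 2 : ℝ)) :=
          setLIntegral_mono' (measurableSet_Ioo.prod measurableSet_ball) hpt
      _ = (2 : ℝ≥0∞) ^ (1 / 2 : ℝ) * (∫⁻ z in I ×ˢ B, ‖pK z.1 z.2‖ₑ ^ (3 / 2 : ℝ)) +
            (2 : ℝ≥0∞) ^ (1 / 2 : ℝ) * ENNReal.ofReal (max Cπ 0) ^ (3 / 2 : ℝ) * volume (I ×ˢ B) := by
          rw [lintegral_add_right' _ aemeasurable_const,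
            lintegral_const_mul'' _ (show AEMeasurable (fun z : ℝ × (EuclideanSpace ℝ (Fin 3)) => ‖pK z.1 z.2‖ₑ ^ (3 / 2 : ℝ))
              (volume.restrict (I ×ˢ B)) from hpKm.enorm.pow_const _), setLIntegral_const]
      _ < ∞ := by
          refine ENNReal.add_lt_top.2 ⟨ENNReal.mul_lt_top (lt_top_iff_ne_top.2 s2) ?_, ?_⟩
          · exact (lintegral_mono_set (Set.prod_mono (hIS.trans (Ioo_subset_Ioo_right hSS₀)) Metric.ball_subset_closedBall)).trans_lt
              (hLK.pressure _ (isCompact_closedBall _ _))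
          · refine ENNReal.mul_lt_top (ENNReal.mul_lt_top (lt_top_iff_ne_top.2 s2)
              (ENNReal.rpow_lt_top_of_nonneg (by norm_num) ENNReal.ofReal_ne_top)) ?_
            exact (measure_mono (Set.prod_mono Ioo_subset_Icc_self Metric.ball_subset_closedBall)).trans_lt
              ((isCompact_Icc.prod (isCompact_closedBall _ _)).measure_lt_top)
  have hkey : (∫⁻ t in I, ‖c t‖ₑ ^ (3 / 2 : ℝ)) * volume B < ∞ := by
    rw [← lintegral_mul_const _ (hcm.enorm.pow_const _), hTonelli]
    exact hfin
  exact lt_top_iff_ne_top.2 fun h => by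
    rw [h, ENNReal.top_mul hB0] at hkey
    exact lt_irrefl _ hkey

/-! ### From slice-wise a.e. to product a.e. -/

/-- If `f(t, x) = g(t)` for a.e. `x`, for a.e. `t ∈ I`, with `f` a.e.-strongly measurable on the
strip and `g` measurable, then `f(z) = g(z.1)` for a.e. `z` in the strip `I × X`. [folklore] -/
theorem ae_strip_eq_time_of_ae_ae {I : Set ℝ} {f : ℝ → (EuclideanSpace ℝ (Fin 3)) → ℝ} {g : ℝ → ℝ}
    (hf : AEStronglyMeasurable (uncurry f) (volume.restrict (I ×ˢ (univ : Set (EuclideanSpace ℝ (Fin 3))))))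
    (hg : Measurable g)
    (h : ∀ᵐ t ∂(volume.restrict I), ∀ᵐ x ∂(volume : Measure (EuclideanSpace ℝ (Fin 3))), f t x = g t) :
    ∀ᵐ z ∂(volume.restrict (I ×ˢ (univ : Set (EuclideanSpace ℝ (Fin 3))))), f z.1 z.2 = g z.1 := by
  have hprod : (volume.restrict I).prod (volume : Measure (EuclideanSpace ℝ (Fin 3))) = volume.restrict (I ×ˢ (univ : Set (EuclideanSpace ℝ (Fin 3)))) := by
    rw [Measure.volume_eq_prod, Measure.restrict_prod_eq_prod_univ]
  rw [← hprod] at hf ⊢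
  have hE : MeasurableSet {z : ℝ × (EuclideanSpace ℝ (Fin 3)) | hf.mk (uncurry f) z = g z.1} :=
    measurableSet_eq_fun hf.stronglyMeasurable_mk.measurable (hg.comp measurable_fst)
  have h1 : uncurry f =ᵐ[(volume.restrict I).prod (volume : Measure (EuclideanSpace ℝ (Fin 3)))] hf.mk (uncurry f) := hf.ae_eq_mk
  have h2 : ∀ᵐ t ∂(volume.restrict I), ∀ᵐ x ∂(volume : Measure (EuclideanSpace ℝ (Fin 3))), uncurry f (t, x) = hf.mk (uncurry f) (t, x) :=
    Measure.ae_ae_of_ae_prod h1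
  have h3 : ∀ᵐ t ∂(volume.restrict I), ∀ᵐ x ∂(volume : Measure (EuclideanSpace ℝ (Fin 3))), (t, x) ∈ {z : ℝ × (EuclideanSpace ℝ (Fin 3)) | hf.mk (uncurry f) z = g z.1} := by
    filter_upwards [h, h2] with t ht h2t
    filter_upwards [ht, h2t] with x hx h2x
    show hf.mk (uncurry f) (t, x) = g t
    rw [← h2x]; exact hx
  have h4 := (Measure.ae_prod_mem_iff_ae_ae_mem hE).2 h3
  filter_upwards [h4, h1] with z hz hz1
  have : uncurry f z = hf.mk (uncurry f) z := hz1
  rw [show f z.1 z.2 = uncurry f z from rfl, this]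
  exact hz

/-! ### The perturbed local energy inequality on the slab -/

set_option maxHeartbeats 1600000 in
/-- **The perturbed local energy inequality on the slab, with the local Leray pressure of the
regular flow** (Jia–Šverák 2014, proof of Thm. 3.1, arXiv p. 8: the local energy inequality for
`v = u - a`; Lemarié-Rieusset 2016, Thm. 14.7, proof p. 516). Let `(u, p)` be a local Leray
solution on `(0,T') × ℝ³` with a weak spatial gradient `G` having the uniformly local bounds of
the class; let `(a, p_K)` be a local Leray solution on `(0,S₀) × ℝ³` and `(a, π)` a classical
solution on `(0, S₂)`, `S₀ ≤ S₂` (the regular flow of `exists_regular_flow`). Then for every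
nonnegative space–time test function `Φ` on the open slab `(0, min(T',S₀)) × ℝ³`, with
`v = u - a`,
`2 ∫∫ |G - Da|² Φ ≤ ∫∫ |v|²(Φₜ + ΔΦ) + ∫∫ |v|² u·∇Φ + 2 ∫∫ (p - p_K) v·∇Φ - 2 ∫∫ Φ ⟪Da(v), v⟫`
(iterated integrals over `ℝ` and `ℝ³`). Proof: `perturbed_local_energy_inequality` on the
sub-slab `(t₁, t₂) × ℝ³` carrying the support of `Φ`, for the globally smooth cut-off flow
`ζ(t) a`, `ζ(t) π` (`ζ = 1` on `[t₁,t₂]`) and the renormalised pressure `p - c(t)`, where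
`c = p_K - π` is the gauge of `exists_gauge_two_pressures`.
[cite: JiaSverak2014, §3 proof of Thm. 3.1 (arXiv p. 8)] [cite: LemarieRieusset2016, Thm. 14.7, proof p. 516] -/
theorem perturbed_local_energy_inequality_slab {T' S₀ S₂ : ℝ}
    {u₀ a₀ : (EuclideanSpace ℝ (Fin 3)) → (EuclideanSpace ℝ (Fin 3))} {u a : ℝ → (EuclideanSpace ℝ (Fin 3)) → (EuclideanSpace ℝ (Fin 3))} {p π pK : ℝ → (EuclideanSpace ℝ (Fin 3)) → ℝ}
    {G : ℝ → (EuclideanSpace ℝ (Fin 3)) → (EuclideanSpace ℝ (Fin 3)) →L[ℝ] (EuclideanSpace ℝ (Fin 3))}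
    (hT' : 0 < T') (hu : IsLocalLeraySolutionOn T' 1 u₀ u p)
    (hG : HasWeakSpatialGradientOn (slab (EuclideanSpace ℝ (Fin 3)) (Ioo 0 T') isOpen_Ioo) u G)
    (hGb : ∀ R : ℝ, 0 < R → ∃ C : ℝ≥0, ∀ x₀ : (EuclideanSpace ℝ (Fin 3)),
      ∫⁻ z in Ioo 0 T' ×ˢ ball x₀ R, ENNReal.ofReal (frobeniusNormSq (G z.1 z.2)) ≤ C)
    (hS₀ : 0 < S₀) (hS₀₂ : S₀ ≤ S₂)
    (hLK : IsLocalLeraySolutionOn S₀ 1 a₀ a pK) (hcl : IsClassicalNSSolutionOn (Ioo 0 S₂) 1 0 a π)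
    {Φ : ℝ → (EuclideanSpace ℝ (Fin 3)) → ℝ} (hΦ : IsSpaceTimeTestOn (slab (EuclideanSpace ℝ (Fin 3)) (Ioo 0 (min T' S₀)) isOpen_Ioo) Φ)
    (hΦ0 : ∀ t x, 0 ≤ Φ t x) :
    2 * ∫ t, ∫ x, frobeniusNormSq (G t x - fderiv ℝ (a t) x) * Φ t x ≤
      (∫ t, ∫ x, ‖u t x - a t x‖ ^ 2 * (timeDeriv Φ t x + Δ (Φ t) x)) +
        (∫ t, ∫ x, ‖u t x - a t x‖ ^ 2 * ⟪u t x, gradient (Φ t) x⟫) +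
        2 * (∫ t, ∫ x, (p t x - pK t x) * ⟪u t x - a t x, gradient (Φ t) x⟫) -
        2 * ∫ t, ∫ x, Φ t x * ⟪fderiv ℝ (a t) x (u t x - a t x), u t x - a t x⟫ := by
  set S : ℝ := min T' S₀ with hSdef
  have hS : 0 < S := lt_min hT' hS₀
  have hST' : S ≤ T' := min_le_left _ _
  have hSS₀ : S ≤ S₀ := min_le_right _ _
  have hSS₂ : S ≤ S₂ := hSS₀.trans hS₀₂
  -- ## the support of `Φ` and its time shadow
  set K : Set (ℝ × (EuclideanSpace ℝ (Fin 3))) := tsupport (uncurry Φ) with hKdef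
  have hKc : IsCompact K := hΦ.hasCompactSupport
  have hKQ : K ⊆ Ioo 0 S ×ˢ (univ : Set (EuclideanSpace ℝ (Fin 3))) := hΦ.tsupport_subset
  have hΦK : ∀ z ∉ K, Φ z.1 z.2 = 0 := fun z hz => image_eq_zero_of_notMem_tsupport (f := uncurry Φ) hz
  have hΦtK : ∀ z ∉ K, timeDeriv Φ z.1 z.2 = 0 := fun z hz => IsSpaceTimeTestOn.timeDeriv_eq_zero_of_notMem hz
  have hgΦK : ∀ z ∉ K, gradient (Φ z.1) z.2 = 0 := fun z hz => by
    rw [gradient, IsSpaceTimeTestOn.fderiv_slice_eq_zero_of_notMem (ψ := Φ) hz, map_zero]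
  have hLΦK : ∀ z ∉ K, (Δ (Φ z.1)) z.2 = 0 := fun z hz =>
    laplacian_eq_zero_of_notMem_tsupport (notMem_tsupport_slice hz)
  -- the degenerate case `Φ = 0`
  rcases K.eq_empty_or_nonempty with hKe | hKne
  · have h0 : ∀ z : ℝ × (EuclideanSpace ℝ (Fin 3)), z ∉ K := fun z hz => by rw [hKe] at hz; exact hz
    have hΦ0' : ∀ t x, Φ t x = 0 := fun t x => hΦK (t, x) (h0 _)
    have hΦt0' : ∀ t x, timeDeriv Φ t x = 0 := fun t x => hΦtK (t, x) (h0 _)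
    have hg0' : ∀ t x, gradient (Φ t) x = 0 := fun t x => hgΦK (t, x) (h0 _)
    have hL0' : ∀ t x, (Δ (Φ t)) x = 0 := fun t x => hLΦK (t, x) (h0 _)
    simp [hΦ0', hg0', hL0']
  -- the time shadow `J = π₁(K)` and the interval `(t₁, t₂) ⊇ J`
  set J : Set ℝ := Prod.fst '' K with hJdef
  have hJc : IsCompact J := hKc.image continuous_fst
  have hJne : J.Nonempty := hKne.image _
  have hJS : J ⊆ Ioo 0 S := by rintro _ ⟨z, hz, rfl⟩; exact (hKQ hz).1
  set t₁' : ℝ := sInf J with ht₁'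
  set t₂' : ℝ := sSup J with ht₂'
  have ht₁'J : t₁' ∈ J := hJc.sInf_mem hJne
  have ht₂'J : t₂' ∈ J := hJc.sSup_mem hJne
  have h1' : 0 < t₁' := (hJS ht₁'J).1
  have h2' : t₂' < S := (hJS ht₂'J).2
  have h12' : t₁' ≤ t₂' := csInf_le hJc.bddBelow ht₂'J
  have hKJ : ∀ z ∈ K, z.1 ∈ Icc t₁' t₂' := fun z hz =>
    ⟨csInf_le hJc.bddBelow ⟨z, hz, rfl⟩, le_csSup hJc.bddAbove ⟨z, hz, rfl⟩⟩
  set t₁ : ℝ := t₁' / 2 with ht₁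
  set t₂ : ℝ := (t₂' + S) / 2 with ht₂
  have h1 : 0 < t₁ := by rw [ht₁]; linarith
  have h11' : t₁ < t₁' := by rw [ht₁]; linarith
  have h22' : t₂' < t₂ := by rw [ht₂]; linarith
  have h2 : t₂ < S := by rw [ht₂]; linarith
  have h12 : t₁ ≤ t₂ := by linarith
  have hKI : ∀ z ∈ K, z.1 ∈ Ioo t₁ t₂ := fun z hz => ⟨h11'.trans_le (hKJ z hz).1, (hKJ z hz).2.trans_lt h22'⟩
  -- ## the plateau and the cut-off flow
  obtain ⟨ζ, hζs, hζ0, hζ1, hζone, hζev, hζsupp⟩ := exists_time_plateau h1 h12 h2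
  have hζS₂ : tsupport ζ ⊆ Ioo 0 S₂ := hζsupp.trans (Icc_subset_Ioo (by linarith) (by linarith))
  set e : ℝ → (EuclideanSpace ℝ (Fin 3)) → (EuclideanSpace ℝ (Fin 3)) := fun t x => ζ t • a t x with hedef
  set πe : ℝ → (EuclideanSpace ℝ (Fin 3)) → ℝ := fun t x => ζ t • π t x with hπedef
  have he : ContDiff ℝ (⊤ : ℕ∞) (uncurry e) := contDiff_uncurry_smul_of_contDiffOn hcl.smooth_velocity hζs hζS₂
  have hπe : ContDiff ℝ (⊤ : ℕ∞) (uncurry πe) := contDiff_uncurry_smul_of_contDiffOn hcl.smooth_pressure hζs hζS₂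
  have heq_e : ∀ t ∈ Icc t₁ t₂, e t = a t := fun t ht => by
    funext x; simp only [hedef, hζone t ht, one_smul]
  have heq_π : ∀ t ∈ Icc t₁ t₂, πe t = π t := fun t ht => by
    funext x; simp only [hπedef, hζone t ht, one_smul]
  -- the pointwise equations on `Ω = (t₁, t₂) × ℝ³`
  set Ω : Opens (ℝ × (EuclideanSpace ℝ (Fin 3))) := slab (EuclideanSpace ℝ (Fin 3)) (Ioo t₁ t₂) isOpen_Ioo with hΩdef
  have hIT' : Ioo t₁ t₂ ⊆ Ioo 0 T' := Ioo_subset_Ioo h1.le (h2.le.trans hST')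
  have hIS₂ : Ioo t₁ t₂ ⊆ Ioo 0 S₂ := Ioo_subset_Ioo h1.le (h2.le.trans hSS₂)
  have hΩT' : Ω ≤ slab (EuclideanSpace ℝ (Fin 3)) (Ioo 0 T') isOpen_Ioo := slab_mono hIT'
  have ha1 : ContDiffOn ℝ 1 (uncurry a) (Ioo 0 S₂ ×ˢ (univ : Set (EuclideanSpace ℝ (Fin 3)))) := hcl.smooth_velocity.of_le (by norm_cast)
  have hmomE : ∀ z ∈ (Ω : Set (ℝ × (EuclideanSpace ℝ (Fin 3)))), HasDerivAt (fun s => e s z.2)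
      ((1 : ℝ) • (Δ (e z.1)) z.2 + (-(fderiv ℝ (e z.1) z.2 (e z.1 z.2)) - gradient (πe z.1) z.2)) z.1 := by
    intro z hz
    have hz1 : z.1 ∈ Ioo t₁ t₂ := mem_slab.1 hz
    have hz1' : z.1 ∈ Ioo (0 : ℝ) S₂ := hIS₂ hz1
    -- the time line of `a` and its derivative
    have hda : HasDerivAt (fun s => a s z.2) (fderiv ℝ (uncurry a) (z.1, z.2) ((1 : ℝ), (0 : (EuclideanSpace ℝ (Fin 3))))) z.1 :=
      hasDerivAt_timeLine_of_contDiffOn ha1 (isOpen_Ioo.mem_nhds hz1') z.2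
    have hmom := hcl.momentum z.1 hz1' z.2
    rw [timeDerivWithin_of_mem_interior (by rwa [interior_Ioo]) z.2, timeDeriv_apply, hda.deriv] at hmom
    have hval : fderiv ℝ (uncurry a) (z.1, z.2) ((1 : ℝ), (0 : (EuclideanSpace ℝ (Fin 3)))) =
        (1 : ℝ) • (Δ (a z.1)) z.2 + (-(fderiv ℝ (a z.1) z.2 (a z.1 z.2)) - gradient (π z.1) z.2) := by
      have := eq_sub_of_add_eq hmom
      rw [this]
      simp only [convect, Pi.zero_apply, add_zero]
      abel
    rw [hval] at hda
    -- transfer to `e` (equal to `a` near `z.1` in time)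
    have hev : (fun s => e s z.2) =ᶠ[𝓝 z.1] fun s => a s z.2 := by
      filter_upwards [hζev z.1 hz1] with s hs
      simp only [hedef, hs, one_smul]
    have hEa : e z.1 = a z.1 := heq_e z.1 (Ioo_subset_Icc_self hz1)
    have hπa : πe z.1 = π z.1 := heq_π z.1 (Ioo_subset_Icc_self hz1)
    rw [hEa, hπa]
    exact hda.congr_of_eventuallyEq hev
  have hdivE : ∀ t, VectorCalculus.IsDivFree (e t) := by
    intro t x
    by_cases ht : ζ t = 0
    · have : e t = fun _ => 0 := by funext y; simp only [hedef, ht, zero_smul]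
      rw [this]
      simp [VectorCalculus.divergence]
    · have ht' : t ∈ Ioo (0 : ℝ) S₂ := hζS₂ (subset_tsupport _ ht)
      have hd : DifferentiableAt ℝ (a t) x := ((hcl.contDiff_velocity ht').differentiable (by simp)) x
      show VectorCalculus.divergence (fun y => ζ t • a t y) x = 0
      rw [divergence_const_smul hd, hcl.divFree t ht' x, mul_zero]
  -- ## the gauge and the renormalised pressure
  obtain ⟨c, hcm, hc⟩ := exists_gauge_two_pressures hSS₀ hSS₂ hLK hcl
  set c' : ℝ → ℝ := (Ioo t₁ t₂).indicator c with hc'def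
  have hc'm : Measurable c' := hcm.indicator measurableSet_Ioo
  have hc'T : ∫⁻ t in Ioo 0 t₂, ‖c' t‖ₑ ^ (3 / 2 : ℝ) < ∞ := by
    have e1 : ∀ t, ‖c' t‖ₑ ^ (3 / 2 : ℝ) = (Ioo t₁ t₂).indicator (fun t => ‖c t‖ₑ ^ (3 / 2 : ℝ)) t := by
      intro t
      by_cases ht : t ∈ Ioo t₁ t₂
      · simp only [hc'def, indicator_of_mem ht]
      · simp only [hc'def, indicator_of_notMem ht, enorm_zero]
        rw [ENNReal.zero_rpow_of_pos (by norm_num)]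
    simp_rw [e1]
    rw [lintegral_indicator measurableSet_Ioo, Measure.restrict_restrict measurableSet_Ioo,
      Ioo_inter_Ioo, max_eq_left h1.le, min_eq_left le_rfl]
    exact lintegral_gauge_rpow_lt_top hSS₀ hSS₂ hLK hcl hcm hc h1 h2
  set p' : ℝ → (EuclideanSpace ℝ (Fin 3)) → ℝ := fun t x => p t x - c' t with hp'def
  have hsuit₂ : IsSuitableWeakSolutionOn (slab (EuclideanSpace ℝ (Fin 3)) (Ioo 0 t₂) isOpen_Ioo) 1 0 u p :=
    hu.suitable.of_le (slab_mono (Ioo_subset_Ioo_right (h2.le.trans hST')))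
  have hsuit' : IsSuitableWeakSolutionOn (slab (EuclideanSpace ℝ (Fin 3)) (Ioo 0 t₂) isOpen_Ioo) 1 0 u p' :=
    Seregin2014Limit.isSuitableWeakSolutionOn_sub_gauge hsuit₂ hc'm hc'T
  have hsΩ : IsSuitableWeakSolutionOn Ω 1 0 u p' := hsuit'.of_le (slab_mono (Ioo_subset_Ioo_left h1.le))
  -- ## the inputs of the abstract inequality on `Ω`
  have hGΩ : HasWeakSpatialGradientOn Ω u G := hG.mono hΩT'
  have hbox : ∀ K' ⊆ (Ω : Set (ℝ × (EuclideanSpace ℝ (Fin 3)))), IsCompact K' → ∃ R : ℝ, 0 < R ∧ K' ⊆ Ioo 0 T' ×ˢ ball (0 : (EuclideanSpace ℝ (Fin 3))) R := by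
    intro K' hK' hK'c
    obtain ⟨R, hR⟩ := (hK'c.image continuous_snd).isBounded.subset_ball (0 : (EuclideanSpace ℝ (Fin 3)))
    refine ⟨max R 1, by positivity, fun z hz => ⟨hIT' (mem_slab.1 (hK' hz)), ?_⟩⟩
    exact ball_subset_ball (le_max_left _ _) (hR (mem_image_of_mem _ hz))
  have hG2 : ∀ K' ⊆ (Ω : Set (ℝ × (EuclideanSpace ℝ (Fin 3)))), IsCompact K' →
      ∫⁻ z in K', ENNReal.ofReal (frobeniusNormSq (G z.1 z.2)) < ∞ := by
    intro K' hK' hK'c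
    obtain ⟨R, hR, hsub⟩ := hbox K' hK' hK'c
    obtain ⟨C, hC⟩ := hGb R hR
    exact (lintegral_mono_set hsub).trans_lt ((hC 0).trans_lt ENNReal.coe_lt_top)
  have hLEI : ∀ φ : ℝ → (EuclideanSpace ℝ (Fin 3)) → ℝ, IsSpaceTimeTestOn Ω φ → (∀ t x, 0 ≤ φ t x) →
      2 * (1 : ℝ) * ∫ t, ∫ x, frobeniusNormSq (G t x) * φ t x ≤
        ∫ t, ∫ x, (‖u t x‖ ^ 2 * (timeDeriv φ t x + 1 * Δ (φ t) x) +
          (‖u t x‖ ^ 2 + 2 * p' t x) * ⟪u t x, gradient (φ t) x⟫ +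
          2 * ⟪(0 : ℝ → (EuclideanSpace ℝ (Fin 3)) → (EuclideanSpace ℝ (Fin 3))) t x, u t x⟫ * φ t x) := by
    intro φ hφ hφ0
    obtain ⟨G₀, hG₀, -, hLEI₀⟩ := hsΩ.localEnergy
    have hGG : ∀ᵐ z ∂(volume : Measure (ℝ × (EuclideanSpace ℝ (Fin 3)))), z ∈ (Ω : Set (ℝ × (EuclideanSpace ℝ (Fin 3)))) → uncurry G z = uncurry G₀ z :=
      (ae_restrict_iff' Ω.isOpen.measurableSet).1 (hGΩ.ae_eq hG₀)
    have hφK : ∀ z ∉ (Ω : Set (ℝ × (EuclideanSpace ℝ (Fin 3)))), φ z.1 z.2 = 0 := fun z hz => hφ.apply_eq_zero hz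
    have e1 : ∫ t, ∫ x, frobeniusNormSq (G t x) * φ t x = ∫ t, ∫ x, frobeniusNormSq (G₀ t x) * φ t x := by
      refine integral_integral_congr_ae_prod (hGG.mono fun z hz => ?_)
      by_cases hzΩ : z ∈ (Ω : Set (ℝ × (EuclideanSpace ℝ (Fin 3))))
      · have : G z.1 z.2 = G₀ z.1 z.2 := hz hzΩ
        rw [this]
      · rw [hφK z hzΩ, mul_zero, mul_zero]
    rw [e1]
    exact hLEI₀ φ hφ hφ0
  have hu3 : ∀ K' ⊆ (Ω : Set (ℝ × (EuclideanSpace ℝ (Fin 3)))), IsCompact K' → MemLp (uncurry u) 3 (volume.restrict K') := by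
    intro K' hK' hK'c
    obtain ⟨R, hR, hsub⟩ := hbox K' hK' hK'c
    have hm : AEStronglyMeasurable (uncurry u) (volume.restrict K') :=
      hu.aestronglyMeasurable.mono_measure (Measure.restrict_mono (hsub.trans (prod_mono Subset.rfl (subset_univ _))) le_rfl)
    refine ⟨hm, ?_⟩
    rw [eLpNorm_lt_top_iff_lintegral_rpow_enorm_lt_top three_ne_zero ENNReal.ofNat_ne_top, ENNReal.toReal_ofNat]
    have hfin := hu.lintegral_cube_box_lt_top 0 R
    refine lt_of_le_of_lt (lintegral_mono_set hsub |>.trans (lintegral_mono fun z => le_of_eq ?_)) hfin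
    rw [show (3 : ℝ) = ((3 : ℕ) : ℝ) by norm_num, ENNReal.rpow_natCast]
    rfl
  have hp32 : ∀ K' ⊆ (Ω : Set (ℝ × (EuclideanSpace ℝ (Fin 3)))), IsCompact K' → MemLp (uncurry p') (3 / 2) (volume.restrict K') := by
    intro K' hK' hK'c
    obtain ⟨R, hR, hsub⟩ := hbox K' hK' hK'c
    have hsub' : K' ⊆ Ioo 0 t₂ ×ˢ ball (0 : (EuclideanSpace ℝ (Fin 3))) R := fun z hz =>
      ⟨⟨(hsub hz).1.1, (mem_slab.1 (hK' hz)).2⟩, (hsub hz).2⟩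
    have h32 : (3 / 2 : ℝ≥0∞) ≠ 0 := by norm_num
    have h32' : (3 / 2 : ℝ≥0∞) ≠ ⊤ := ENNReal.div_ne_top (by norm_num) (by norm_num)
    have hto : ((3 / 2 : ℝ≥0∞)).toReal = (3 / 2 : ℝ) := by rw [ENNReal.toReal_div]; norm_num
    -- `p` on `K'`
    have hpm : AEStronglyMeasurable (uncurry p) (volume.restrict K') :=
      hu.aestronglyMeasurable_pressure.mono_measure (Measure.restrict_mono (hsub.trans (prod_mono Subset.rfl (subset_univ _))) le_rfl)
    have hpK' : MemLp (uncurry p) (3 / 2) (volume.restrict K') := by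
      refine ⟨hpm, ?_⟩
      rw [eLpNorm_lt_top_iff_lintegral_rpow_enorm_lt_top h32 h32', hto]
      exact (lintegral_mono_set (hsub.trans (prod_mono Subset.rfl Metric.ball_subset_closedBall))).trans_lt
        (hu.pressure _ (isCompact_closedBall _ _))
    -- `c'` on `K'`
    have hcK' : MemLp (fun z : ℝ × (EuclideanSpace ℝ (Fin 3)) => c' z.1) (3 / 2) (volume.restrict K') := by
      refine ⟨(hc'm.comp measurable_fst).aestronglyMeasurable, ?_⟩
      rw [eLpNorm_lt_top_iff_lintegral_rpow_enorm_lt_top h32 h32', hto]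
      calc ∫⁻ z in K', ‖c' z.1‖ₑ ^ (3 / 2 : ℝ) ≤ ∫⁻ z in Ioo 0 t₂ ×ˢ ball (0 : (EuclideanSpace ℝ (Fin 3))) R, ‖c' z.1‖ₑ ^ (3 / 2 : ℝ) :=
            lintegral_mono_set hsub'
        _ = (∫⁻ t in Ioo 0 t₂, ‖c' t‖ₑ ^ (3 / 2 : ℝ)) * volume (ball (0 : (EuclideanSpace ℝ (Fin 3))) R) :=
            lintegral_prod_of_time_only (g := fun t => ‖c' t‖ₑ ^ (3 / 2 : ℝ)) (hc'm.enorm.pow_const _) _ _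
        _ < ∞ := ENNReal.mul_lt_top hc'T measure_ball_lt_top
    exact hpK'.sub hcK'
  have hΦΩ : IsSpaceTimeTestOn Ω Φ :=
    ⟨hΦ.contDiff, hΦ.hasCompactSupport, fun z hz => mem_slab.2 (hKI z hz)⟩
  -- ## the abstract inequality
  have h4 := perturbed_local_energy_inequality (ν := (1 : ℝ)) hsΩ.distributional hGΩ hG2 hLEI hu3 hp32
    he hπe hmomE hdivE hΦΩ hΦ0
  -- ## back to `a`, `π` and `p - p_K`
  have hKe : ∀ z ∈ K, e z.1 = a z.1 := fun z hz => heq_e z.1 (Ioo_subset_Icc_self (hKI z hz))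
  have hE1 : ∀ t x, frobeniusNormSq (G t x - fderiv ℝ (e t) x) * Φ t x =
      frobeniusNormSq (G t x - fderiv ℝ (a t) x) * Φ t x := by
    intro t x
    by_cases hz : ((t, x) : ℝ × (EuclideanSpace ℝ (Fin 3))) ∈ K
    · rw [hKe _ hz]
    · simp only [hΦK _ hz, mul_zero]
  have hE2 : ∀ t x, ‖u t x - e t x‖ ^ 2 * (timeDeriv Φ t x + 1 * Δ (Φ t) x) =
      ‖u t x - a t x‖ ^ 2 * (timeDeriv Φ t x + Δ (Φ t) x) := by
    intro t x
    by_cases hz : ((t, x) : ℝ × (EuclideanSpace ℝ (Fin 3))) ∈ K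
    · rw [hKe _ hz, one_mul]
    · simp only [hΦtK _ hz, hLΦK _ hz, mul_zero, add_zero]
  have hEg : ∀ t x, ‖u t x - e t x‖ ^ 2 * ⟪u t x, gradient (Φ t) x⟫ =
      ‖u t x - a t x‖ ^ 2 * ⟪u t x, gradient (Φ t) x⟫ := by
    intro t x
    by_cases hz : ((t, x) : ℝ × (EuclideanSpace ℝ (Fin 3))) ∈ K
    · rw [hKe _ hz]
    · simp only [hgΦK _ hz, inner_zero_right, mul_zero]
  have hE5 : ∀ t x, Φ t x * ⟪fderiv ℝ (e t) x (u t x - e t x), u t x - e t x⟫ =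
      Φ t x * ⟪fderiv ℝ (a t) x (u t x - a t x), u t x - a t x⟫ := by
    intro t x
    by_cases hz : ((t, x) : ℝ × (EuclideanSpace ℝ (Fin 3))) ∈ K
    · rw [hKe _ hz]
    · simp only [hΦK _ hz, zero_mul]
  -- the pressure term, a.e.
  have hcS : ∀ᵐ z ∂(volume.restrict (Ioo 0 S ×ˢ (univ : Set (EuclideanSpace ℝ (Fin 3))))), pK z.1 z.2 - π z.1 z.2 = c z.1 := by
    have hpKm : AEStronglyMeasurable (uncurry pK) (volume.restrict (Ioo 0 S ×ˢ (univ : Set (EuclideanSpace ℝ (Fin 3))))) :=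
      hLK.aestronglyMeasurable_pressure.mono_measure
        (Measure.restrict_mono (prod_mono (Ioo_subset_Ioo_right hSS₀) Subset.rfl) le_rfl)
    have hπm : AEStronglyMeasurable (uncurry π) (volume.restrict (Ioo 0 S ×ˢ (univ : Set (EuclideanSpace ℝ (Fin 3))))) :=
      (hcl.smooth_pressure.continuousOn.mono (prod_mono (Ioo_subset_Ioo_right hSS₂) Subset.rfl)).aestronglyMeasurable
        (measurableSet_Ioo.prod MeasurableSet.univ)
    exact ae_strip_eq_time_of_ae_ae (f := fun t x => pK t x - π t x) (hpKm.sub hπm) hcm hc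
  have hE4 : ∀ᵐ z : ℝ × (EuclideanSpace ℝ (Fin 3)) ∂volume, (p' z.1 z.2 - πe z.1 z.2) * ⟪u z.1 z.2 - e z.1 z.2, gradient (Φ z.1) z.2⟫ =
      (p z.1 z.2 - pK z.1 z.2) * ⟪u z.1 z.2 - a z.1 z.2, gradient (Φ z.1) z.2⟫ := by
    have h' := (ae_restrict_iff' (measurableSet_Ioo.prod MeasurableSet.univ)).1 hcS
    filter_upwards [h'] with z hz
    by_cases hzK : z ∈ K
    · have hzI : z.1 ∈ Ioo t₁ t₂ := hKI z hzK
      have hzS : z ∈ Ioo 0 S ×ˢ (univ : Set (EuclideanSpace ℝ (Fin 3))) := hKQ hzK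
      have hc' : c' z.1 = c z.1 := indicator_of_mem hzI _
      have hea : e z.1 z.2 = a z.1 z.2 := by rw [hKe z hzK]
      have hπa : πe z.1 z.2 = π z.1 z.2 := by rw [heq_π z.1 (Ioo_subset_Icc_self hzI)]
      rw [hea, hπa]
      simp only [hp'def, hc']
      rw [← hz hzS]
      ring
    · simp only [hgΦK z hzK, inner_zero_right, mul_zero]
  have cE1 : ∫ t, ∫ x, frobeniusNormSq (G t x - fderiv ℝ (e t) x) * Φ t x =
      ∫ t, ∫ x, frobeniusNormSq (G t x - fderiv ℝ (a t) x) * Φ t x := by simp_rw [hE1]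
  have cE2 : ∫ t, ∫ x, ‖u t x - e t x‖ ^ 2 * (timeDeriv Φ t x + 1 * Δ (Φ t) x) =
      ∫ t, ∫ x, ‖u t x - a t x‖ ^ 2 * (timeDeriv Φ t x + Δ (Φ t) x) := by simp_rw [hE2]
  have cEg : ∫ t, ∫ x, ‖u t x - e t x‖ ^ 2 * ⟪u t x, gradient (Φ t) x⟫ =
      ∫ t, ∫ x, ‖u t x - a t x‖ ^ 2 * ⟪u t x, gradient (Φ t) x⟫ := by simp_rw [hEg]
  have cE5 : ∫ t, ∫ x, Φ t x * ⟪fderiv ℝ (e t) x (u t x - e t x), u t x - e t x⟫ =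
      ∫ t, ∫ x, Φ t x * ⟪fderiv ℝ (a t) x (u t x - a t x), u t x - a t x⟫ := by simp_rw [hE5]
  have cE4 : ∫ t, ∫ x, (p' t x - πe t x) * ⟪u t x - e t x, gradient (Φ t) x⟫ =
      ∫ t, ∫ x, (p t x - pK t x) * ⟪u t x - a t x, gradient (Φ t) x⟫ :=
    integral_integral_congr_ae_prod hE4
  rw [cE1, cE2, cEg, cE4, cE5] at h4
  linarith

end JiaSverak2014

end Literature.Analysis.FluidPDE

end
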